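import Literature.ModelTheory.ExponentialFields.AuxiliarySystem
import Literature.ModelTheory.ExponentialFields.ExpPolyCodeLawful
import Literature.ModelTheory.ExponentialFields.CodeNewtonSentences
import HarnessLib

/-!
# The Last Root Conjecture separates exponential polynomials from `0` at non-singular zeros

Family `periods` (periods.S26/S27), topic `Literature/ModelTheory/ExponentialFields`, in support of
the named fact
`Literature.ModelTheory.ExponentialFields.macintyreWilkie_realExpDecidable_iff_lastRootConjecture`
(`LastRootConjecture.lean`: `RealExpDecidable ↔ LastRootConjecture`, Macintyre–Wilkie 1996 as
reported by Berarducci–Servi 2004, p. 44).  First file of the direction `←` (the Last Root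
Conjecture implies the decidability of `Th(ℝ_exp)`, granted Macintyre–Wilkie's effective model
completeness `macintyreWilkie_recursiveSubtheory`): the passage from Berarducci–Servi's *Last Root
Conjecture* (a computable bound on the norm of the non-singular zeros of an `n × n` system of
exponential polynomials over `ℤ`) to the form in which Macintyre–Wilkie use their *Weak Schanuel
Conjecture* — a computable `θ(n, F, P)` with `P(ā) = 0 ∨ |P(ā)| > θ⁻¹` at every non-singular
zero `ā` of `F` — through the auxiliary square system `(F, x_{n+1} · P − 1)`, whose zero
`(ā, P(ā)⁻¹)` is non-singular exactly when `ā` is (Jones–Servi 2011, proof of Thm. 3.11, system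
`H`; here on the monomial codes `ExpPolyCode` of `LastRootConjecture.lean`, so that `θ` is
computable).

## Contents (all proved)

* `ExpPolyCode.toMv` — the integer polynomial `P ∈ ℤ[x̄, ȳ]` of a code, with
  `evalWith_eq_expAEval_toMv` (any commutative ring with an `E`), `eval_eq_expEval_toMv` (`ℝ`),
  `eval_pdCode_eq_expPD` (code derivatives are the partial derivatives `ExpPoly.expPD`) and
  `jac_eq_expJac` (the Jacobian `ExpPolyCode.jac` is `ExpPoly.expJac` of the polynomials);
* `ExpPolyCode.liftCode n d` (a code in `n` unknowns read in `n + d` unknowns) and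
  `ExpPolyCode.mulVarCode N v` (multiplication by the unknown `x_v`), with their semantics
  `evalWith_liftCode`, `evalWith_mulVarCode` in any commutative ring with an `E`, and their
  primitive recursiveness;
* `ExpPolyCode.auxCode n F P` — the auxiliary system, `sysMap_auxCode` (its map is that of
  `ExpPoly.auxSystem` of the polynomials), **`isNonsingularZero_auxCode`**, `primrec_auxCode`;
* **`ExpPolyCode.exists_separation_of_lastRootConjecture`**: under `LastRootConjecture` there is
  a computable `θ` with `1 < θ(n, F, P) · |P(ā)|` at every zero `ā` of the rows of `F` with
  invertible Jacobian and `P(ā) ≠ 0`.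

## References

* A. Macintyre, A. J. Wilkie, *On the decidability of the real exponential field*, in:
  Kreiseliana, A K Peters (1996), 441–467 (the Weak Schanuel Conjecture; primary source not held).
* A. Berarducci, T. Servi, *An effective version of Wilkie's theorem of the complement and some
  effective o-minimality results*, Ann. Pure Appl. Logic 125 (2004), p. 44 (Last Root Conjecture).
* G. O. Jones, T. Servi, *On the decidability of the real field with a generic power function*,
  J. Symb. Log. 76 (2011), proof of Thm. 3.11 (the auxiliary system `H`).
-/

noncomputable section

open scoped BigOperators Matrix
open MvPolynomial

namespace Literature.ModelTheory.ExponentialFields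

namespace ExpPolyCode

/-! ### Codes as integer polynomials in `(x̄, ȳ)` -/

/-- The integer polynomial `P ∈ ℤ[x₁…xₙ, y₁…yₙ]` of a code: the monomial `(c, e)` is
`c · ∏ᵢ xᵢ^{e[i]} yᵢ^{e[n+i]}`. [folklore] -/
def toMv (n : ℕ) (p : ExpPolyCode) : MvPolynomial (Fin n ⊕ Fin n) ℤ :=
  (p.map fun m : ℤ × List ℕ =>
    C m.1 * ∏ i : Fin n, X (Sum.inl i) ^ m.2.getD i 0 * X (Sum.inr i) ^ m.2.getD (n + i) 0).sum

/-- **In any commutative ring with a map `E`, a code evaluates to its polynomial at `(x̄, E x̄)`.** [folklore] -/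
theorem evalWith_eq_expAEval_toMv {K : Type*} [CommRing K] (E : K → K) (n : ℕ) (p : ExpPolyCode)
    (x : Fin n → K) : evalWith E n p x = ExpPoly.expAEval E (toMv n p) x := by
  unfold evalWith toMv ExpPoly.expAEval
  rw [map_list_sum, List.map_map]
  congr 1
  refine List.map_congr_left fun m _ => ?_
  simp only [Function.comp_apply, map_mul, map_prod, map_pow, MvPolynomial.aeval_X,
    Sum.elim_inl, Sum.elim_inr, monomialEvalWith, eq_intCast, map_intCast]

/-- In `ℝ`: `eval n p x̄ = (toMv n p)(x̄, e^{x̄})`. [folklore] -/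
theorem eval_eq_expEval_toMv (n : ℕ) (p : ExpPolyCode) (x : Fin n → ℝ) :
    eval n p x = ExpPoly.expEval (toMv n p) x := by
  rw [← evalWith_real, evalWith_eq_expAEval_toMv, ExpPoly.expAEval_real]

/-- The code derivative evaluates to the partial derivative of the polynomial (both are the
partial derivative of the same function). [folklore] -/
theorem eval_pdCode_eq_expPD (n : ℕ) (p : ExpPolyCode) (x : Fin n → ℝ) (k : Fin n) :
    eval n (pdCode n k p) x = ExpPoly.expPD k (toMv n p) x := by
  rw [← fderiv_eval_single, ← ExpPoly.fderiv_expEval_single]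
  congr 2
  exact funext fun y => eval_eq_expEval_toMv n p y

/-- The Jacobian matrix of a code system is the Jacobian `expJac` of its polynomials. [folklore] -/
theorem jac_eq_expJac (n : ℕ) (F : List ExpPolyCode) (x : Fin n → ℝ) :
    jac n F x = ExpPoly.expJac (fun i => toMv n (F.getD i [])) x := by
  ext i j
  rw [jac_eq_jacFun, jacFun_rowTerm_eq, realize_pdRowTerm, eval_pdCode_eq_expPD]
  rfl

/-! ### `evalWith` bookkeeping -/

section EvalWith

variable {K : Type*} [CommRing K] (E : K → K)

/-- `evalWith` is additive over concatenation of codes. [folklore] -/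
theorem evalWith_append (n : ℕ) (p q : ExpPolyCode) (x : Fin n → K) :
    evalWith E n (p ++ q) x = evalWith E n p x + evalWith E n q x := by
  simp [evalWith, List.map_append, List.sum_append]

/-- `evalWith` of a mapped list of monomials. [folklore] -/
theorem evalWith_map' (n : ℕ) (f : ℤ × List ℕ → ℤ × List ℕ) (p : ExpPolyCode) (x : Fin n → K) :
    evalWith E n (p.map f) x = (p.map fun m => monomialEvalWith E n (f m) x).sum := by
  simp [evalWith, List.map_map, Function.comp_def]

/-- The constant monomial `(c, [])` evaluates to `c`. [folklore] -/
@[simp] theorem monomialEvalWith_const (n : ℕ) (c : ℤ) (x : Fin n → K) :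
    monomialEvalWith E n (c, []) x = c := by
  simp [monomialEvalWith]

/-! ### Lifting codes to more unknowns -/

/-- the exponent list of a monomial in `n` unknowns re-indexed to `n + d` unknowns: the new
unknowns `x_{n+1}, …, x_{n+d}` and their exponentials get exponent `0` (positions `< n`: the
`xᵢ`; positions `n + d + i`, `i < n`: the `e^{xᵢ}`; lists normalised to length `2(n+d)`) [folklore] -/
def liftExp (n d : ℕ) (e : List ℕ) : List ℕ :=
  (List.range (n + d + (n + d))).map fun i =>
    if i < n then e.getD i 0 else if i < n + d then 0 else if i < n + d + n then e.getD (i - d) 0 else 0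

/-- Reading the exponents off `liftExp`. [folklore] -/
theorem getD_liftExp (n d : ℕ) (e : List ℕ) (i : ℕ) :
    (liftExp n d e).getD i 0 =
      if i < n then e.getD i 0 else if i < n + d then 0 else if i < n + d + n then e.getD (i - d) 0 else 0 := by
  unfold liftExp
  rw [List.getD_eq_getElem?_getD, List.getElem?_map]
  by_cases hi : i < n + d + (n + d)
  · rw [List.getElem?_range hi]
    rfl
  · rw [List.getElem?_eq_none (by simpa using not_lt.1 hi)]
    have h1 : ¬ i < n := by omega
    have h2 : ¬ i < n + d := by omega
    have h3 : ¬ i < n + d + n := by omega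
    simp [h1, h2, h3]

/-- the lift of a monomial to `n + d` unknowns [folklore] -/
def liftMono (n d : ℕ) (m : ℤ × List ℕ) : ℤ × List ℕ := (m.1, liftExp n d m.2)

/-- **the lift of a code to `n + d` unknowns** (the same exponential polynomial, read in the first
`n` of `n + d` unknowns) [folklore] -/
def liftCode (n d : ℕ) (p : ExpPolyCode) : ExpPolyCode := p.map (liftMono n d)

/-- Semantics of the lifted monomial: its value at `ȳ ∈ K^{n+d}` is the value of the monomial at
the first `n` coordinates. [folklore] -/
theorem monomialEvalWith_liftMono (n d : ℕ) (m : ℤ × List ℕ) (y : Fin (n + d) → K) :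
    monomialEvalWith E (n + d) (liftMono n d m) y = monomialEvalWith E n m (fun i => y (Fin.castAdd d i)) := by
  unfold monomialEvalWith liftMono
  simp only
  rw [Fin.prod_univ_add]
  have h2 : ∏ j : Fin d, y (Fin.natAdd n j) ^ (liftExp n d m.2).getD (Fin.natAdd n j : ℕ) 0 *
      E (y (Fin.natAdd n j)) ^ (liftExp n d m.2).getD (n + d + (Fin.natAdd n j : ℕ)) 0 = 1 := by
    refine Finset.prod_eq_one fun j _ => ?_
    have hj := j.is_lt
    rw [getD_liftExp, getD_liftExp]
    simp only [Fin.val_natAdd]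
    have a1 : ¬ n + (j : ℕ) < n := by omega
    have a2 : n + (j : ℕ) < n + d := by omega
    have a3 : ¬ n + d + (n + (j : ℕ)) < n := by omega
    have a4 : ¬ n + d + (n + (j : ℕ)) < n + d := by omega
    have a5 : ¬ n + d + (n + (j : ℕ)) < n + d + n := by omega
    simp [a1, a2, a3, a4, a5]
  rw [h2, mul_one]
  congr 1
  refine Finset.prod_congr rfl fun i _ => ?_
  have hi := i.is_lt
  rw [getD_liftExp, getD_liftExp]
  simp only [Fin.val_castAdd]
  have b2 : ¬ n + d + (i : ℕ) < n := by omega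
  have b3 : ¬ n + d + (i : ℕ) < n + d := by omega
  have b4 : n + d + (i : ℕ) < n + d + n := by omega
  have b5 : n + d + (i : ℕ) - d = n + i := by omega
  simp [hi, b2, b3, b4, b5]

/-- **Semantics of the lifted code.** [folklore] -/
theorem evalWith_liftCode (n d : ℕ) (p : ExpPolyCode) (y : Fin (n + d) → K) :
    evalWith E (n + d) (liftCode n d p) y = evalWith E n p (fun i => y (Fin.castAdd d i)) := by
  rw [liftCode, evalWith_map']
  simp only [monomialEvalWith_liftMono]
  rfl

/-! ### Multiplying a code by an unknown -/

/-- the exponent list with the exponent of `x_v` increased by one (lists normalised to length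
`2N`, `N` the number of unknowns) [folklore] -/
def bumpExp (N v : ℕ) (e : List ℕ) : List ℕ :=
  (List.range (N + N)).map fun i => if i = v then e.getD i 0 + 1 else e.getD i 0

/-- Reading the exponents off `bumpExp` (positions `< 2N`, the only ones ever read). [folklore] -/
theorem getD_bumpExp (N v : ℕ) (e : List ℕ) {i : ℕ} (hi : i < N + N) :
    (bumpExp N v e).getD i 0 = if i = v then e.getD i 0 + 1 else e.getD i 0 := by
  unfold bumpExp
  rw [List.getD_eq_getElem?_getD, List.getElem?_map, List.getElem?_range hi]
  rfl

/-- the monomial multiplied by the unknown `x_v` [folklore] -/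
def mulVarMono (N v : ℕ) (m : ℤ × List ℕ) : ℤ × List ℕ := (m.1, bumpExp N v m.2)

/-- **the code multiplied by the unknown `x_v`** [folklore] -/
def mulVarCode (N v : ℕ) (p : ExpPolyCode) : ExpPolyCode := p.map (mulVarMono N v)

/-- Semantics of `mulVarMono`: multiplication by `y_v`. [folklore] -/
theorem monomialEvalWith_mulVarMono (N : ℕ) {v : ℕ} (hv : v < N) (m : ℤ × List ℕ) (y : Fin N → K) :
    monomialEvalWith E N (mulVarMono N v m) y = y ⟨v, hv⟩ * monomialEvalWith E N m y := by
  unfold monomialEvalWith mulVarMono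
  simp only
  have key : ∀ i : Fin N, y i ^ (bumpExp N v m.2).getD (i : ℕ) 0 * E (y i) ^ (bumpExp N v m.2).getD (N + i) 0 =
      (if i = ⟨v, hv⟩ then y i else 1) * (y i ^ m.2.getD (i : ℕ) 0 * E (y i) ^ m.2.getD (N + i) 0) := by
    intro i
    rw [getD_bumpExp N v _ (i := i) (by omega), getD_bumpExp N v _ (i := N + i) (by omega)]
    have hne : (N + i : ℕ) ≠ v := by omega
    rw [if_neg hne]
    by_cases h : (i : ℕ) = v
    · have h' : i = ⟨v, hv⟩ := Fin.ext h
      subst h'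
      simp [pow_succ]
      ring
    · have h' : i ≠ ⟨v, hv⟩ := fun h' => h (by rw [h'])
      rw [if_neg h, if_neg h', one_mul]
  rw [Finset.prod_congr rfl fun i _ => key i, Finset.prod_mul_distrib, Finset.prod_ite_eq']
  simp only [Finset.mem_univ, if_true]
  ring

/-- **Semantics of `mulVarCode`**: multiplication by `y_v`. [folklore] -/
theorem evalWith_mulVarCode (N : ℕ) {v : ℕ} (hv : v < N) (p : ExpPolyCode) (y : Fin N → K) :
    evalWith E N (mulVarCode N v p) y = y ⟨v, hv⟩ * evalWith E N p y := by
  induction p with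
  | nil => simp [mulVarCode]
  | cons m p ih =>
    rw [mulVarCode, List.map_cons, evalWith_cons, ← mulVarCode, ih, monomialEvalWith_mulVarMono E N hv,
      evalWith_cons, mul_add]

/-! ### The auxiliary square system `(F̂, x_{n+1} · P − 1)` on codes -/

/-- **Macintyre–Wilkie's auxiliary system on codes**: for a system `F` of `n` codes in `n`
unknowns and a further code `P`, the `n + 1` codes `(F₁, …, Fₙ, x_{n+1} · P − 1)` in `n + 1`
unknowns (rows beyond the length of `F` read as `0`, as in `sysMap`). At a zero `ā` of `F` with
`P(ā) ≠ 0`, `(ā, P(ā)⁻¹)` is a zero of it, non-singular iff `ā` is non-singular for `F`; this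
is the device by which a bound on the norm of non-singular zeros (the Last Root Conjecture) bounds
`|P(ā)|` away from `0` (Macintyre–Wilkie's *Weak Schanuel Conjecture* form). [cite: JonesServi2011, Thm. 3.11 (proof; the system `H`)] -/
def auxCode (n : ℕ) (F : List ExpPolyCode) (P : ExpPolyCode) : List ExpPolyCode :=
  (List.range n).map (fun i => liftCode n 1 (F.getD i [])) ++
    [mulVarCode (n + 1) n (liftCode n 1 P) ++ [(-1, [])]]

/-- `auxCode` has `n + 1` rows. [folklore] -/
@[simp] theorem length_auxCode (n : ℕ) (F : List ExpPolyCode) (P : ExpPolyCode) :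
    (auxCode n F P).length = n + 1 := by
  simp [auxCode]

/-- The first `n` rows of `auxCode`. [folklore] -/
theorem getD_auxCode_lt (n : ℕ) (F : List ExpPolyCode) (P : ExpPolyCode) {i : ℕ} (hi : i < n) :
    (auxCode n F P).getD i [] = liftCode n 1 (F.getD i []) := by
  rw [auxCode, List.getD_eq_getElem?_getD, List.getElem?_append_left (by simpa using hi), List.getElem?_map,
    List.getElem?_range hi]
  rfl

/-- The last row of `auxCode`. [folklore] -/
theorem getD_auxCode_last (n : ℕ) (F : List ExpPolyCode) (P : ExpPolyCode) :
    (auxCode n F P).getD n [] = mulVarCode (n + 1) n (liftCode n 1 P) ++ [(-1, [])] := by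
  rw [auxCode, List.getD_eq_getElem?_getD, List.getElem?_append_right (by simp)]
  simp

/-- Semantics of the first `n` rows: `Fᵢ` at the first `n` coordinates. [folklore] -/
theorem evalWith_auxCode_castSucc (n : ℕ) (F : List ExpPolyCode) (P : ExpPolyCode) (y : Fin (n + 1) → K)
    (i : Fin n) :
    evalWith E (n + 1) ((auxCode n F P).getD i []) y = evalWith E n (F.getD i []) (fun j => y (Fin.castSucc j)) := by
  rw [getD_auxCode_lt n F P i.is_lt, evalWith_liftCode]
  rfl

/-- Semantics of the last row: `y_{n+1} · P(ȳ|ₙ) − 1`. [folklore] -/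
theorem evalWith_auxCode_last (n : ℕ) (F : List ExpPolyCode) (P : ExpPolyCode) (y : Fin (n + 1) → K) :
    evalWith E (n + 1) ((auxCode n F P).getD n []) y =
      y (Fin.last n) * evalWith E n P (fun j => y (Fin.castSucc j)) - 1 := by
  rw [getD_auxCode_last, evalWith_append, evalWith_mulVarCode E (n + 1) (Nat.lt_succ_self n), evalWith_liftCode]
  simp [evalWith, sub_eq_add_neg]
  rfl

end EvalWith

/-! ### The auxiliary system in `ℝ`: the non-singular zero `(ā, P(ā)⁻¹)` -/

/-- The map of the auxiliary code system is the map of `ExpPoly.auxSystem` of the polynomials of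
the codes. [folklore] -/
theorem sysMap_auxCode (n : ℕ) (F : List ExpPolyCode) (P : ExpPolyCode) :
    sysMap (n + 1) (auxCode n F P) =
      fun y i => ExpPoly.expEval (ExpPoly.auxSystem (fun l => toMv n (F.getD l [])) (toMv n P) i) y := by
  funext y i
  rw [sysMap, ← ExpPoly.expAEval_real, ← evalWith_real]
  refine Fin.lastCases ?_ (fun l => ?_) i
  · rw [Fin.val_last, evalWith_auxCode_last, ExpPoly.auxSystem_last, ExpPoly.expAEval_auxLast,
      evalWith_eq_expAEval_toMv]
    rfl
  · rw [Fin.val_castSucc, evalWith_auxCode_castSucc, ExpPoly.auxSystem_castSucc, ExpPoly.expAEval_liftP,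
      evalWith_eq_expAEval_toMv]
    rfl

/-- **`(ā, P(ā)⁻¹)` is a non-singular zero of the auxiliary code system** when `ā` is a
non-singular zero of `F` (zero rows, invertible Jacobian) with `P(ā) ≠ 0`. [cite: JonesServi2011, Thm. 3.11 (proof)] -/
theorem isNonsingularZero_auxCode {n : ℕ} {F : List ExpPolyCode} {P : ExpPolyCode} {a : Fin n → ℝ}
    (hF : ∀ i : Fin n, eval n (F.getD i []) a = 0) (hP : eval n P a ≠ 0) (hJ : (jac n F a).det ≠ 0) :
    IsNonsingularZero (n + 1) (auxCode n F P) (Fin.snoc a (eval n P a)⁻¹) := by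
  set M : Fin n → MvPolynomial (Fin n ⊕ Fin n) ℤ := fun l => toMv n (F.getD l []) with hM
  set y : Fin (n + 1) → ℝ := Fin.snoc a (eval n P a)⁻¹ with hy
  have hya : (y ∘ Fin.castSucc) = a := funext fun i => by simp [hy]
  have hMa : ∀ l, ExpPoly.expEval (M l) a = 0 := fun l => by rw [hM, ← eval_eq_expEval_toMv]; exact hF l
  have hPa : ExpPoly.expEval (toMv n P) a = eval n P a := (eval_eq_expEval_toMv n P a).symm
  refine ⟨length_auxCode n F P, ?_, ?_⟩
  · rw [sysMap_auxCode]
    funext i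
    have h := (ExpPoly.aux_zero_iff Real.exp M (toMv n P) y).2
      ⟨fun l => by rw [ExpPoly.expAEval_real, hya]; exact hMa l,
       by rw [ExpPoly.expAEval_real, hya, hPa]; simp [hy, inv_mul_cancel₀ hP]⟩
    have := h i
    rwa [ExpPoly.expAEval_real] at this
  · rw [sysMap_auxCode, ExpPoly.det_fderiv_expEval_pi, ExpPoly.det_expJac_auxSystem, hya, hPa, ← hM,
      ← jac_eq_expJac]
    exact mul_ne_zero hP hJ


/-! ### Computability of the auxiliary system -/

section Computability

open Primrec

/-- `liftExp` is primitive recursive. [folklore] -/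
theorem primrec_liftExp : Primrec fun p : ℕ × ℕ × List ℕ => liftExp p.1 p.2.1 p.2.2 := by
  unfold liftExp
  refine list_map (list_range.comp (nat_add.comp (nat_add.comp fst (fst.comp snd))
    (nat_add.comp fst (fst.comp snd)))) ?_
  have hn : Primrec fun q : (ℕ × ℕ × List ℕ) × ℕ => q.1.1 := fst.comp fst
  have hd : Primrec fun q : (ℕ × ℕ × List ℕ) × ℕ => q.1.2.1 := fst.comp (snd.comp fst)
  have he : Primrec fun q : (ℕ × ℕ × List ℕ) × ℕ => q.1.2.2 := snd.comp (snd.comp fst)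
  have hi : Primrec fun q : (ℕ × ℕ × List ℕ) × ℕ => q.2 := snd
  refine (ite (nat_lt.comp hi hn) ((list_getD 0).comp he hi)
    (ite (nat_lt.comp hi (nat_add.comp hn hd)) (const 0)
      (ite (nat_lt.comp hi (nat_add.comp (nat_add.comp hn hd) hn)) ((list_getD 0).comp he (nat_sub.comp hi hd))
        (const 0)))).to₂

/-- `liftCode` is primitive recursive. [folklore] -/
theorem primrec_liftCode : Primrec fun p : ℕ × ℕ × ExpPolyCode => liftCode p.1 p.2.1 p.2.2 := by
  unfold liftCode
  refine list_map (snd.comp snd) ?_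
  exact (pair (fst.comp snd) (primrec_liftExp.comp (pair (fst.comp fst) (pair (fst.comp (snd.comp fst))
    (snd.comp snd))))).to₂

/-- `bumpExp` is primitive recursive. [folklore] -/
theorem primrec_bumpExp : Primrec fun p : ℕ × ℕ × List ℕ => bumpExp p.1 p.2.1 p.2.2 := by
  unfold bumpExp
  refine list_map (list_range.comp (nat_add.comp fst fst)) ?_
  have hv : Primrec fun q : (ℕ × ℕ × List ℕ) × ℕ => q.1.2.1 := fst.comp (snd.comp fst)
  have he : Primrec fun q : (ℕ × ℕ × List ℕ) × ℕ => q.1.2.2 := snd.comp (snd.comp fst)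
  have hi : Primrec fun q : (ℕ × ℕ × List ℕ) × ℕ => q.2 := snd
  exact (ite (Primrec.eq.comp hi hv) (nat_add.comp ((list_getD 0).comp he hi) (const 1))
    ((list_getD 0).comp he hi)).to₂

/-- `mulVarCode` is primitive recursive. [folklore] -/
theorem primrec_mulVarCode : Primrec fun p : ℕ × ℕ × ExpPolyCode => mulVarCode p.1 p.2.1 p.2.2 := by
  unfold mulVarCode
  refine list_map (snd.comp snd) ?_
  exact (pair (fst.comp snd) (primrec_bumpExp.comp (pair (fst.comp fst) (pair (fst.comp (snd.comp fst))
    (snd.comp snd))))).to₂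

/-- **`auxCode` is primitive recursive** in `(n, F, P)`. [folklore] -/
theorem primrec_auxCode : Primrec fun p : ℕ × List ExpPolyCode × ExpPolyCode => auxCode p.1 p.2.1 p.2.2 := by
  unfold auxCode
  have hn : Primrec fun p : ℕ × List ExpPolyCode × ExpPolyCode => p.1 := fst
  have hF : Primrec fun p : ℕ × List ExpPolyCode × ExpPolyCode => p.2.1 := fst.comp snd
  have hP : Primrec fun p : ℕ × List ExpPolyCode × ExpPolyCode => p.2.2 := snd.comp snd
  have hlift : Primrec fun q : (ℕ × List ExpPolyCode × ExpPolyCode) × ExpPolyCode => liftCode q.1.1 1 q.2 :=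
    primrec_liftCode.comp (pair (hn.comp fst) (pair (const 1) snd))
  refine list_append.comp (list_map (list_range.comp hn) ?_) ?_
  · exact (hlift.comp (pair fst ((list_getD ([] : ExpPolyCode)).comp (hF.comp fst) snd))).to₂
  · refine list_cons.comp (list_append.comp ?_ (const [((-1 : ℤ), ([] : List ℕ))])) (const [])
    exact primrec_mulVarCode.comp (pair (nat_add.comp hn (const 1)) (pair hn (hlift.comp (pair Primrec.id hP))))

end Computability

/-! ### Macintyre–Wilkie's Weak Schanuel Conjecture from the Last Root Conjecture -/

/-- The sup norm of `(ā, c)` dominates `|c|`. [folklore] -/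
theorem abs_le_norm_snoc {n : ℕ} (a : Fin n → ℝ) (c : ℝ) : |c| ≤ ‖(Fin.snoc a c : Fin (n + 1) → ℝ)‖ := by
  have h := norm_le_pi_norm (Fin.snoc a c : Fin (n + 1) → ℝ) (Fin.last n)
  rwa [Fin.snoc_last, Real.norm_eq_abs] at h

/-- **The Last Root Conjecture implies Macintyre–Wilkie's Weak Schanuel Conjecture** (in the
form consumed below): there is a computable `θ(n, F, P) ∈ ℕ` such that at every non-singular zero
`ā` of the `n × n` system `F` of exponential polynomials over `ℤ`, either `P(ā) = 0` or
`|P(ā)| > θ(n, F, P)⁻¹` — by the Last Root bound for the auxiliary system `(F, x_{n+1} P − 1)` at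
its non-singular zero `(ā, P(ā)⁻¹)`. (Macintyre–Wilkie phrase their conjecture with such an
auxiliary `g = P`; Berarducci–Servi 2004, p. 44, with the norm bound.) [cite: BerarducciServi2004, p. 44] -/
theorem exists_separation_of_lastRootConjecture (hL : LastRootConjecture) :
    ∃ θ : ℕ × List ExpPolyCode × ExpPolyCode → ℕ, Computable θ ∧
      ∀ (n : ℕ) (F : List ExpPolyCode) (P : ExpPolyCode) (a : Fin n → ℝ),
        (∀ i : Fin n, eval n (F.getD i []) a = 0) → (jac n F a).det ≠ 0 → eval n P a ≠ 0 →
          1 < θ (n, F, P) * |eval n P a| := by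
  obtain ⟨η, hη, hbound⟩ := hL
  refine ⟨fun p => η (p.1 + 1, auxCode p.1 p.2.1 p.2.2), ?_, fun n F P a hF hJ hP => ?_⟩
  · exact hη.comp (Computable.pair (Primrec.nat_add.to_comp.comp Computable.fst (Computable.const 1))
      primrec_auxCode.to_comp)
  · have h := lt_of_le_of_lt (abs_le_norm_snoc a (eval n P a)⁻¹)
      (hbound (n + 1) (auxCode n F P) _ (isNonsingularZero_auxCode hF hP hJ))
    have hpos : 0 < |eval n P a| := abs_pos.2 hP
    rw [abs_inv, inv_lt_iff_one_lt_mul₀ hpos] at h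
    simpa [mul_comm] using h

end ExpPolyCode

end Literature.ModelTheory.ExponentialFields

end
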